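import Mathlib.LinearAlgebra.Eigenspace.Minpoly
import Mathlib.FieldTheory.Minpoly.Field
import Mathlib.RingTheory.Polynomial.Basic
import HarnessLib

/-!
# An isotypic quasi-projector in the algebra generated by a commuting family (Fitting's lemma via Bézout)

Topic `LinearAlgebra`; namespace `Literature.LinearAlgebra.CommutingFamily` (as the tree's `CommutingFamilyFittingProjection`).
Mathlib only; theorems only (no definition, no named fact, no instance, no notation).

Let `V` be a finite-dimensional vector space over a field `F`, `T_i` (`i ∈ s`, `s` finite) pairwise commuting endomorphisms,
`a_i ∈ F`, and `φ : V → W` linear with `φ ∘ T_i = a_i φ` (`φ` is `a`-isotypic).  Then there is an element `e` of the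
`F`-subalgebra `F[T_i] ⊂ End V` with

* `φ ∘ e = φ`, and `e(V) ⊆ ⋂_i V[(T_i − a_i)^∞]` (the joint generalised `a`-eigenspace)  — `exists_quasiProjector_mem_adjoin`;
* hence, if the joint generalised eigenspace meets `ker φ` trivially («multiplicity one»), `e` KILLS `ker φ`
  — `exists_quasiProjector_of_inf_eq_bot`.

One operator (`exists_fitting_mem_adjoin`): with `μ = minpoly`, `μ = X^r u`, `X ∤ u`, Bézout `A X^{r+1} + B u = 1` gives
`e = (Bu)(g) ∈ F[g]` with `g^{r+1} e = 0` and `1 − e = g ∘ (A X^r)(g)` (Jacobson, *Basic Algebra II*, §3.4, Fitting's lemma; the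
projector is a polynomial in the operator).  The family statement is the product of the one-operator quasi-projectors
(commuting operators preserve each other's generalised eigenspaces, Mathlib `Module.End.mapsTo_maxGenEigenspace_of_comm`).

Typical use (route BSD/TeichmullerTwistDescent, K-line): `V = H₁(X₀(N), ℚ)`, `T_i` Hecke operators, `φ` the period map of a
newform `f`; the output is the Hecke quasi-projector `e_f ∈ ℚ[T_q]` onto the `f`-part.

## References
* N. Jacobson, *Basic Algebra II* (1989), §3.4, Fitting's lemma (38). [Jacobson1989BasicAlgebraII]
* K. Hoffman, R. Kunze, *Linear Algebra* (1971), §6.8 Thm. 12 (primary decomposition: the projections are polynomials in `T`).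
  [HoffmanKunze1971]
-/

namespace Literature.LinearAlgebra.CommutingFamily

open Polynomial Module

variable {F V W : Type*} [Field F] [AddCommGroup V] [Module F V] [FiniteDimensional F V] [AddCommGroup W] [Module F W]

/-- **Fitting quasi-projector as a polynomial** (one operator, eigenvalue `0`): for `g ∈ End V` there is `e ∈ F[g]` with
`e(V) ⊆ V[g^∞]` (`= ⋃_k ker g^k`) and `v − e v ∈ g(V)` for all `v`. [cite: Jacobson1989BasicAlgebraII, §3.4 (38)] -/
theorem exists_fitting_mem_adjoin_zero (g : Module.End F V) :
    ∃ e ∈ Algebra.adjoin F {g}, (∀ v, e v ∈ g.maxGenEigenspace 0) ∧ ∀ v, ∃ w, v - e v = g w := by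
  have hμ : minpoly F g ≠ 0 := minpoly.ne_zero (Algebra.IsIntegral.isIntegral g)
  obtain ⟨u, hμu, hXu⟩ := Polynomial.exists_eq_pow_rootMultiplicity_mul_and_not_dvd (minpoly F g) hμ 0
  rw [map_zero, sub_zero] at hμu hXu
  set r := (minpoly F g).rootMultiplicity 0 with hr
  have hcop : IsCoprime ((X : F[X]) ^ (r + 1)) u :=
    ((Polynomial.irreducible_X (R := F)).coprime_iff_not_dvd.mpr hXu).pow_left
  obtain ⟨A, B, hAB⟩ := hcop
  refine ⟨aeval g (B * u), Polynomial.aeval_mem_adjoin_singleton F g, fun v => ?_, fun v => ?_⟩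
  · rw [Module.End.mem_maxGenEigenspace]
    refine ⟨r + 1, ?_⟩
    rw [zero_smul, sub_zero]
    have h1 : g ^ (r + 1) * aeval g (B * u) = 0 := by
      have e1 : (X : F[X]) ^ (r + 1) * (B * u) = (B * X) * minpoly F g := by rw [hμu]; ring
      rw [← Polynomial.aeval_X_pow (R := F) g, ← map_mul, e1, map_mul, minpoly.aeval, mul_zero]
    rw [← Module.End.mul_apply, h1, LinearMap.zero_apply]
  · refine ⟨aeval g (A * X ^ r) v, ?_⟩
    have h1 : aeval g (A * X ^ (r + 1)) v + aeval g (B * u) v = v := by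
      rw [← LinearMap.add_apply, ← map_add, hAB, map_one, Module.End.one_apply]
    have h2 : g (aeval g (A * X ^ r) v) = aeval g (A * X ^ (r + 1)) v := by
      have h3 : aeval g (A * X ^ (r + 1)) = g * aeval g (A * X ^ r) := by
        rw [show A * X ^ (r + 1) = X * (A * X ^ r) by ring, map_mul, Polynomial.aeval_X]
      rw [h3, Module.End.mul_apply]
    rw [h2]
    exact sub_eq_of_eq_add h1.symm

/-- **Fitting quasi-projector as a polynomial** (one operator, eigenvalue `μ`): there is `e ∈ F[f]` with `e(V) ⊆ V[(f − μ)^∞]`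
and `v − e v ∈ (f − μ)(V)`. [cite: Jacobson1989BasicAlgebraII, §3.4 (38); HoffmanKunze1971, §6.8 Thm. 12] -/
theorem exists_fitting_mem_adjoin (f : Module.End F V) (μ : F) :
    ∃ e ∈ Algebra.adjoin F {f}, (∀ v, e v ∈ f.maxGenEigenspace μ) ∧ ∀ v, ∃ w, v - e v = (f - μ • 1) w := by
  obtain ⟨e, he, hgen, hsub⟩ := exists_fitting_mem_adjoin_zero (f - μ • 1)
  have hle : Algebra.adjoin F {f - μ • (1 : Module.End F V)} ≤ Algebra.adjoin F {f} := by
    refine Algebra.adjoin_le (Set.singleton_subset_iff.mpr ?_)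
    exact sub_mem (Algebra.self_mem_adjoin_singleton F f)
      (Subalgebra.smul_mem _ (Subalgebra.one_mem _) μ)
  refine ⟨e, hle he, fun v => ?_, hsub⟩
  have h := hgen v
  rw [Module.End.mem_maxGenEigenspace] at h ⊢
  obtain ⟨k, hk⟩ := h
  exact ⟨k, by rwa [zero_smul, sub_zero] at hk⟩

omit [FiniteDimensional F V] in
/-- Elements of `F[S]` commute with every operator commuting with all of `S`. [cite: Jacobson1989BasicAlgebraII, §3.4] -/
theorem commute_of_mem_adjoin (S : Set (Module.End F V)) {x : Module.End F V} (hx : ∀ t ∈ S, Commute t x)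
    {e : Module.End F V} (he : e ∈ Algebra.adjoin F S) : Commute x e := by
  have hle : Algebra.adjoin F S ≤ Subalgebra.centralizer F {x} := by
    refine Algebra.adjoin_le fun t ht => ?_
    rw [SetLike.mem_coe, Subalgebra.mem_centralizer_iff]
    intro y hy
    rw [Set.mem_singleton_iff.mp hy]
    exact (hx t ht).symm.eq
  have h := hle he
  rw [Subalgebra.mem_centralizer_iff] at h
  exact h x rfl

/-- **The isotypic quasi-projector of a commuting family**: for pairwise commuting `T_i` (`i ∈ s`), scalars `a_i` and an
`a`-isotypic `φ` (`φ ∘ T_i = a_i φ`), there is `e ∈ F[T_i : i]` with `φ ∘ e = φ` and `e(V) ⊆ ⋂_{i ∈ s} V[(T_i − a_i)^∞]`.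
[cite: Jacobson1989BasicAlgebraII, §3.4 (38); HoffmanKunze1971, §6.8 Thm. 12] -/
theorem exists_quasiProjector_mem_adjoin {ι : Type*} (s : Finset ι) (T : ι → Module.End F V)
    (hcomm : ∀ i j, Commute (T i) (T j)) (a : ι → F) (φ : V →ₗ[F] W) :
    (∀ i ∈ s, ∀ v, φ (T i v) = a i • φ v) →
    ∃ e ∈ Algebra.adjoin F (Set.range T), (∀ v, φ (e v) = φ v) ∧ ∀ i ∈ s, ∀ v, e v ∈ (T i).maxGenEigenspace (a i) := by
  classical
  induction s using Finset.induction_on with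
  | empty =>
    intro _
    exact ⟨1, Subalgebra.one_mem _, fun v => rfl, fun i hi => absurd hi (Finset.notMem_empty i)⟩
  | insert i s hi ih =>
    intro hφ
    obtain ⟨e, he, hφe, hmem⟩ := ih fun j hj => hφ j (Finset.mem_insert_of_mem hj)
    obtain ⟨eᵢ, heᵢ, hgenᵢ, hsubᵢ⟩ := exists_fitting_mem_adjoin (T i) (a i)
    have hTi : T i ∈ Algebra.adjoin F (Set.range T) := Algebra.subset_adjoin (Set.mem_range_self i)
    have heᵢ' : eᵢ ∈ Algebra.adjoin F (Set.range T) := Algebra.adjoin_le (Set.singleton_subset_iff.mpr hTi) heᵢ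
    refine ⟨eᵢ * e, mul_mem heᵢ' he, fun v => ?_, fun j hj v => ?_⟩
    · obtain ⟨w, hw⟩ := hsubᵢ (e v)
      have h0 : φ (e v - eᵢ (e v)) = 0 := by
        rw [hw, LinearMap.sub_apply, LinearMap.smul_apply, Module.End.one_apply, map_sub, map_smul,
          hφ i (Finset.mem_insert_self i s), sub_self]
      rw [map_sub, sub_eq_zero] at h0
      rw [Module.End.mul_apply, ← h0, hφe]
    · rw [Module.End.mul_apply]
      rcases Finset.mem_insert.mp hj with rfl | hj'
      · exact hgenᵢ (e v)
      · have hc : Commute (T j) eᵢ :=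
          commute_of_mem_adjoin {T i} (fun t ht => by rw [Set.mem_singleton_iff.mp ht]; exact hcomm i j) heᵢ
        exact Module.End.mapsTo_maxGenEigenspace_of_comm hc (a j) (hmem j hj' v)

/-- **Multiplicity one ⇒ the quasi-projector kills `ker φ`**: if moreover the joint generalised `a`-eigenspace meets `ker φ`
trivially, there is `e ∈ F[T_i : i]` with `φ ∘ e = φ` and `e(ker φ) = 0`. [cite: Jacobson1989BasicAlgebraII, §3.4 (38)] -/
theorem exists_quasiProjector_of_inf_eq_bot {ι : Type*} (s : Finset ι) (T : ι → Module.End F V)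
    (hcomm : ∀ i j, Commute (T i) (T j)) (a : ι → F) (φ : V →ₗ[F] W) (hφ : ∀ i ∈ s, ∀ v, φ (T i v) = a i • φ v)
    (hMO : ∀ v, (∀ i ∈ s, v ∈ (T i).maxGenEigenspace (a i)) → φ v = 0 → v = 0) :
    ∃ e ∈ Algebra.adjoin F (Set.range T), (∀ v, φ (e v) = φ v) ∧ ∀ v, φ v = 0 → e v = 0 := by
  obtain ⟨e, he, hφe, hmem⟩ := exists_quasiProjector_mem_adjoin s T hcomm a φ hφ
  exact ⟨e, he, hφe, fun v hv => hMO (e v) (fun i hi => hmem i hi v) (by rw [hφe, hv])⟩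

end Literature.LinearAlgebra.CommutingFamily
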